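import Literature.Computability.MetaComplexity.MCSP
import Literature.Computability.MetaComplexity.TruthTablesProofs
import HarnessLib

/-!
# Complexity meta: `MCSP` inside `MCSP*` — discharges (D-0014)

Discharges the named fact `boolPair_encode_some_mem_MCSPStar_iff` of
`Literature.Computability.MetaComplexity.MCSP`: a *total* truth table, read as a partial one
without `⋆` ("don't care") entries, is a yes-instance of the partial-function Minimum Circuit
Size Problem `MCSP*` iff it is a yes-instance of `MCSP`, i.e. iff `circuitSizeOver B2 f ≤ s`.

Source. S. Hirahara, *NP-hardness of learning programs and partial MCSP*, FOCS 2022; full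
version ECCC TR22-119 (2022). There (§1.2, p. 4) `MCSP` is the set of pairs (truth table of a
total `f : {0,1}ⁿ → {0,1}`, `s`) such that a circuit of size `s` computes `f`, and (§1.2, p. 4;
Def. 8.4, pp. 29–30) `MCSP*` is the set of pairs (`f : {0,1}ⁿ → {0,1,⋆}`, `s`) such that a circuit
of size `s` computes some total function *consistent* with `f`, i.e. agreeing with `f` on
`f⁻¹({0,1})`. A total function is consistent with itself and with nothing else, so on `⋆`-free
tables the two problems coincide; this file proves exactly that for the tree's encodings.

Proof architecture.
* `boolPair_encode_mem_MCSPStar_iff` peels the instance encoding: `boolPair` is injective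
  (`boolUnpair_boolPair`), the list/option encodings are injective (`Encoding.encode_injective`),
  the binary numeral is injective (`decodeNat`), and the list length `2ⁿ` determines the arity `n`
  (`Nat.pow_right_injective`); what remains is the defining condition of `MCSP*` for the given
  table.
* `boolPair_encode_some_mem_MCSPStar_iff_holds`: for the table `some ∘ tt f`, a consistent circuit
  *computes* `f`, so its size bounds `circuitSizeOver B2 f` (`circuitSizeOver_le_of_computes`);
  conversely the infimum `circuitSizeOver B2 f` is attained by an actual `B₂`-circuit
  (`exists_computes_B2_size_eq_holds`, `TruthTablesProofs.lean`), which is consistent with the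
  table.
* `boolPair_truthTable_mem_MCSP_iff_mem_MCSPStar` records the printed remark itself:
  `⟨tt f, s⟩ ∈ MCSP ↔ ⟨(tt f).map some, s⟩ ∈ MCSP*`.

## References

* S. Hirahara, *NP-hardness of learning programs and partial MCSP*, Proc. 63rd IEEE FOCS (2022),
  968–979, doi:10.1109/FOCS54457.2022.00095; full version ECCC TR22-119, §1.2 and Def. 8.4
  [Hirahara2022].
* V. Kabanets, J.-Y. Cai, *Circuit minimization problem*, STOC 2000, §2 (`MCSP`) [KabanetsCai2000].
-/

namespace Literature.Computability.MetaComplexity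

open _root_.Computability Complexity

variable {n : ℕ}

/-- Membership of a well-formed instance in `MCSP*`: for a partial truth table
`T : Fin (2ⁿ) → Option Bool` and a size bound `s`, the string `boolPair (enc T) (bin s)` lies in
`MCSPStar` iff some circuit over `B2` on `n` inputs with at most `s` gates agrees with `T` on every
defined entry. (The instance determines `n`, `T` and `s`: `boolPair`, the list/option encodings
and the binary numeral are injective, and the length `2ⁿ` of the table determines `n`.)
(Hirahara 2022, full version ECCC TR22-119, Def. 8.4, "`MCSP*`"). [cite: Hirahara2022, ECCC TR22-119 Def. 8.4] -/
theorem boolPair_encode_mem_MCSPStar_iff (T : Fin (2 ^ n) → Option Bool) (s : ℕ) :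
    boolPair ((encodingBoolBool.optionBool).listBool.encode (List.ofFn T)) (encodeNat s) ∈
        MCSPStar ↔
      ∃ C : Circuit (Fin n), C.IsOver B2 ∧ C.size ≤ s ∧
        ∀ (i : Fin (2 ^ n)) (b : Bool), T i = some b → C.eval ((boolFunEquivFin n).symm i) = b := by
  constructor
  · rintro ⟨m, T', s', hw, hC⟩
    have h := congrArg boolUnpair hw
    simp only [boolUnpair_boolPair, Prod.mk.injEq] at h
    obtain ⟨hTT, hs⟩ := h
    obtain rfl : s = s' := by simpa using congrArg decodeNat hs
    have hl := (encodingBoolBool.optionBool).listBool.encode_injective hTT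
    have hlen := congrArg List.length hl
    simp only [List.length_ofFn] at hlen
    obtain rfl : n = m := Nat.pow_right_injective le_rfl hlen
    obtain rfl : T = T' := List.ofFn_injective hl
    exact hC
  · intro hC
    exact ⟨n, T, s, rfl, hC⟩

/-- **Discharge of `boolPair_encode_some_mem_MCSPStar_iff`** (`MCSP.lean`). A total truth table,
viewed as a partial one with no `⋆` entries, is a yes-instance of `MCSP*` iff
`circuitSizeOver B2 f ≤ s`: a circuit consistent with the table `some ∘ tt f` computes `f`, so
its size bounds the circuit complexity (`circuitSizeOver_le_of_computes`); conversely the minimum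
`circuitSizeOver B2 f` is attained by a `B₂`-circuit (`exists_computes_B2_size_eq_holds`), which
is consistent with the table. This is the remark that `MCSP` is the special case of `MCSP*` on
`⋆`-free partial functions: a total function is consistent only with itself
(Hirahara 2022, full version ECCC TR22-119, §1.2 p. 4 and Def. 8.4). [cite: Hirahara2022, ECCC TR22-119 §1.2 and Def. 8.4] -/
theorem boolPair_encode_some_mem_MCSPStar_iff_holds :
    boolPair_encode_some_mem_MCSPStar_iff (n := n) := by
  intro f s
  rw [boolPair_encode_mem_MCSPStar_iff]
  constructor
  · rintro ⟨C, hC, hsize, hT⟩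
    refine (circuitSizeOver_le_of_computes C hC fun x => ?_).trans hsize
    simpa using hT (boolFunEquivFin n x) (f x) (by simp)
  · intro hf
    obtain ⟨C, hC, hCf, hCs⟩ := exists_computes_B2_size_eq_holds f
    refine ⟨C, hC, hCs ▸ hf, ?_⟩
    rintro i b ⟨rfl⟩
    exact hCf _

/-- `MCSP` is the special case of `MCSP*` without `⋆` entries: for a total `f : {0,1}ⁿ → {0,1}`
and `s : ℕ`, `⟨tt f, bin s⟩ ∈ MCSP` iff `⟨enc ((tt f).map some), bin s⟩ ∈ MCSP*` — both say
`circuitSizeOver B2 f ≤ s` (`boolPair_truthTable_mem_MCSP_iff`,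
`boolPair_encode_some_mem_MCSPStar_iff_holds`)
(Hirahara 2022, full version ECCC TR22-119, §1.2 p. 4 and Def. 8.4). [cite: Hirahara2022, ECCC TR22-119 §1.2 and Def. 8.4] -/
theorem boolPair_truthTable_mem_MCSP_iff_mem_MCSPStar (f : (Fin n → Bool) → Bool) (s : ℕ) :
    boolPair (truthTable f) (encodeNat s) ∈ MCSP ↔
      boolPair ((encodingBoolBool.optionBool).listBool.encode ((truthTable f).map some))
        (encodeNat s) ∈ MCSPStar := by
  rw [boolPair_truthTable_mem_MCSP_iff, truthTable, List.map_ofFn]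
  exact (boolPair_encode_some_mem_MCSPStar_iff_holds f s).symm

end Literature.Computability.MetaComplexity
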